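import Mathlib
import HarnessLib
import Summits.NavierStokesRegularity.NavierStokesRegularity.Theorems.QuarterLogPincerHelmholtzCentreDefs
import Literature.Analysis.FluidPDE.LocalBiotSavartHelmholtz
import Literature.Analysis.FluidPDE.BiotSavartBounds
import Literature.Analysis.FluidPDE.TaoEnstrophyLocalisation

/-!
# Route `QuarterLogPincer`, crux `TypeIQuantSubcubicExp` (stmt-NavierStokesRegularity-24077), line `vortical_centre` —
# H1 `stub_helmholtzNearField : HelmholtzNearField` BY NAME

VERBATIM port (body byte-identical) of ★ `helmholtzNearField_holds : HelmholtzNearField` and `stub_helmholtzNearField` from ns-idea-7's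
`Cruxes/TypeIQuantSubcubicExp/Lines/vortical_centre.lean` (v1.1/v1.2, tree sha16 51dbd9e0ddc6fe01; idea-crit-4 re-stamp PASS 09:43:55Z «H1 PROVED»):
the near/far split of the Biot–Savart integral of the cut-off vorticity at the centre — `|K(z)| ≤ (4π|z|²)⁻¹`, near part `≤ ρ‖curlCLM‖L` over
`B(y,ρ)`, far part by `|K| ≤ (4πρ²)⁻¹` and Cauchy–Schwarz on `B(y,R)` (tree `BiotSavartBounds`, `TaoEnstrophyLocalisation`).  The rest of the line's
kernel (H2 ⟸ H2♭, Sb ⟸ H1 + H2, products) is `…HelmholtzCentreKernel`.  HONEST FRAME: linear potential theory for `C²` fields; it closes one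
registered stub of a line four levels below the crux; nothing here bears on 24077's truth, W7 or Navier–Stokes regularity (OPEN / not proved).
pub-ns-dss typer (g38), `--supports stmt-NavierStokesRegularity-24077`; body by ns-idea-7 (g13).
-/

set_option linter.dupNamespace false

noncomputable section

open MeasureTheory Set Function Filter Topology Metric
open scoped ENNReal NNReal
open Literature.Analysis Literature.Analysis.FluidPDE

namespace Summit.NavierStokesRegularity.NavierStokesRegularity.Cruxes.TypeIQuantSubcubicExp.HelmholtzCentre

/-- **H1 PROVED (v1.1).**  Near/far splitting at the centre: the integrand `‖K(y−x)(χω)(x)‖` is dominated by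
`(4π)⁻¹(κL·1_{|y−x|<ρ}|y−x|⁻² + ρ⁻²‖χω(x)‖)` (`κ = ‖curlCLM‖`; tree `norm_biotSavartKernel_le`, `norm_curl_le`), whose
integral is `κLρ + (4πρ²)⁻¹∫‖χω‖` (tree `integral_kernelMajorant`), and `∫‖χω‖ ≤ ∫_{B(y,R)}‖curl v‖ ≤ |B(y,R)|^{1/2}√W =
√(V₁R³)√W` (Cauchy–Schwarz; `V₁ = |B(0,1)|`, `Measure.addHaar_ball_of_pos`).  Constant `C = max(1, κ, (4π)⁻¹√V₁)`. -/
theorem helmholtzNearField_holds : HelmholtzNearField := by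
  classical
  set V₁ : ℝ := (volume (ball (0 : EuclideanSpace ℝ (Fin 3)) 1)).toReal with hV₁
  have hV₁0 : 0 ≤ V₁ := ENNReal.toReal_nonneg
  set κ : ℝ := ‖curlCLM‖ with hκ
  have hκ0 : 0 ≤ κ := by rw [hκ]; exact norm_nonneg curlCLM
  set C : ℝ := max 1 (max κ ((4 * Real.pi)⁻¹ * Real.sqrt V₁)) with hC
  have hC1 : 1 ≤ C := le_max_left _ _
  have hCκ : κ ≤ C := (le_max_left _ _).trans (le_max_right _ _)
  have hCV : (4 * Real.pi)⁻¹ * Real.sqrt V₁ ≤ C := (le_max_right _ _).trans (le_max_right _ _)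
  have hC0 : 0 ≤ C := by linarith
  refine ⟨C, hC1, ?_⟩
  intro v hv y ρ R L W hρ hρR hL hW hW0
  have hR : 0 < R := by linarith
  set ω' : (EuclideanSpace ℝ (Fin 3)) → (EuclideanSpace ℝ (Fin 3)) := cutVorticity v y R with hω'
  -- (1) pointwise facts about the cut-off vorticity
  have hω'le : ∀ x, ‖ω' x‖ ≤ ‖curl v x‖ := by
    intro x
    rw [hω', cutVorticity_apply, norm_smul, Real.norm_eq_abs, abs_of_nonneg (ballCutoff_nonneg _ _ _)]
    exact mul_le_of_le_one_left (norm_nonneg _) (ballCutoff_le_one _ _ _)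
  have hω'zero : ∀ x, R ≤ ‖x - y‖ → ω' x = 0 := by
    intro x hx
    rw [hω', cutVorticity_apply, ballCutoff_eq_zero (by positivity : 0 < R / 3) (by linarith), zero_smul]
  have hsupp : support ω' ⊆ ball y R := by
    intro x hx
    rw [mem_ball, dist_eq_norm]
    by_contra h
    exact hx (hω'zero x (not_lt.mp h))
  have hcurl_cont : Continuous (curl v) := by
    rw [curl_eq_curlCLM_comp]
    exact curlCLM.continuous.comp (hv.continuous_fderiv (by norm_num))
  have hω'cont : Continuous ω' := by
    have : ω' = fun x => ballCutoff y (R / 3) x • curl v x := rfl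
    rw [this]
    exact (contDiff_ballCutoff y (R / 3) (n := 0)).continuous.smul hcurl_cont
  have hω'cs : HasCompactSupport ω' := by
    refine HasCompactSupport.intro (isCompact_closedBall y R) fun x hx => hω'zero x ?_
    rw [mem_closedBall, dist_eq_norm, not_le] at hx
    exact hx.le
  have hω'int : Integrable ω' := hω'cont.integrable_of_hasCompactSupport hω'cs
  -- (2) the near bound for `curl v` on `B(y,ρ)`
  have hLnonneg : 0 ≤ L := (norm_nonneg _).trans (hL y (mem_ball_self hρ))
  have hcurl_near : ∀ x ∈ ball y ρ, ‖curl v x‖ ≤ κ * L := by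
    intro x hx
    have e : ‖fderiv ℝ v x‖ = ‖iteratedFDeriv ℝ 1 v x‖ := by
      rw [← norm_iteratedFDeriv_zero (𝕜 := ℝ) (f := fderiv ℝ v) (x := x), norm_iteratedFDeriv_fderiv]
    calc ‖curl v x‖ ≤ ‖curlCLM‖ * ‖fderiv ℝ v x‖ := norm_curl_le v x
      _ = κ * ‖iteratedFDeriv ℝ 1 v x‖ := by rw [hκ, e]
      _ ≤ κ * L := by gcongr; exact hL x hx
  -- (3) the integrable majorant of the Biot–Savart integrand
  set g : (EuclideanSpace ℝ (Fin 3)) → ℝ :=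
    fun x => (4 * Real.pi)⁻¹ * ((κ * L) * kernelMajorant ρ (y - x) + (ρ ^ 2)⁻¹ * ‖ω' x‖) with hg
  have hkm_int : Integrable (fun x => kernelMajorant ρ (y - x)) := (integrable_kernelMajorant ρ).comp_sub_left y
  have hgint : Integrable g :=
    ((hkm_int.const_mul _).add (hω'int.norm.const_mul _)).const_mul _
  have hpt : ∀ x, ‖biotSavartKernel (y - x) (ω' x)‖ ≤ g x := by
    intro x
    have hK := norm_biotSavartKernel_le (y - x) (ω' x)
    by_cases hx : ‖y - x‖ < ρ
    · have hxball : x ∈ ball y ρ := by rwa [mem_ball, dist_eq_norm, norm_sub_rev]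
      have hmaj : kernelMajorant ρ (y - x) = (‖y - x‖ ^ 2)⁻¹ := by
        rw [kernelMajorant, indicator_of_mem (mem_ball_zero_iff.mpr hx)]
      have hωx : ‖ω' x‖ ≤ κ * L := (hω'le x).trans (hcurl_near x hxball)
      calc ‖biotSavartKernel (y - x) (ω' x)‖ ≤ (4 * Real.pi)⁻¹ * ‖ω' x‖ * (‖y - x‖ ^ 2)⁻¹ := hK
        _ ≤ (4 * Real.pi)⁻¹ * (κ * L) * (‖y - x‖ ^ 2)⁻¹ := by gcongr
        _ = (4 * Real.pi)⁻¹ * ((κ * L) * kernelMajorant ρ (y - x)) := by rw [hmaj]; ring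
        _ ≤ g x := by
            have h0 : 0 ≤ (4 * Real.pi)⁻¹ * ((ρ ^ 2)⁻¹ * ‖ω' x‖) := by positivity
            simp only [hg, mul_add]
            linarith
    · have hx' : ρ ≤ ‖y - x‖ := not_lt.mp hx
      have hinv : (‖y - x‖ ^ 2)⁻¹ ≤ (ρ ^ 2)⁻¹ :=
        inv_anti₀ (by positivity) (pow_le_pow_left₀ hρ.le hx' 2)
      calc ‖biotSavartKernel (y - x) (ω' x)‖ ≤ (4 * Real.pi)⁻¹ * ‖ω' x‖ * (‖y - x‖ ^ 2)⁻¹ := hK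
        _ ≤ (4 * Real.pi)⁻¹ * ‖ω' x‖ * (ρ ^ 2)⁻¹ := by gcongr
        _ = (4 * Real.pi)⁻¹ * ((ρ ^ 2)⁻¹ * ‖ω' x‖) := by ring
        _ ≤ g x := by
            have h0 : 0 ≤ (4 * Real.pi)⁻¹ * ((κ * L) * kernelMajorant ρ (y - x)) := by
              have := kernelMajorant_nonneg ρ (y - x)
              positivity
            simp only [hg, mul_add]
            linarith
  -- (4) integrate the majorant
  have hI : ‖biotSavart ω' y‖ ≤ ∫ x, g x := by
    rw [biotSavart]
    exact (norm_integral_le_integral_norm _).trans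
      (integral_mono_of_nonneg (Eventually.of_forall fun x => norm_nonneg _) hgint (Eventually.of_forall hpt))
  have hIg : ∫ x, g x = (κ * L) * ρ + (4 * Real.pi)⁻¹ * (ρ ^ 2)⁻¹ * ∫ x, ‖ω' x‖ := by
    simp only [hg]
    rw [integral_const_mul, integral_add (hkm_int.const_mul _) (hω'int.norm.const_mul _), integral_const_mul,
      integral_const_mul, integral_sub_left_eq_self (kernelMajorant ρ) volume y, integral_kernelMajorant hρ.le]
    field_simp
  -- (5) the far mass by Cauchy–Schwarz on `B(y,R)`
  have hfar : ∫ x, ‖ω' x‖ ≤ Real.sqrt (V₁ * R ^ 3) * Real.sqrt W := by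
    have h1 : ∫ x, ‖ω' x‖ = (∫⁻ x, ‖ω' x‖ₑ).toReal := by
      rw [integral_eq_lintegral_of_nonneg_ae (Eventually.of_forall fun x => norm_nonneg _)
        hω'int.norm.aestronglyMeasurable]
      simp_rw [ofReal_norm]
    have h2 : ∫⁻ x, ‖ω' x‖ₑ = ∫⁻ x in ball y R, ‖ω' x‖ₑ := by
      refine (setLIntegral_eq_of_support_subset ?_).symm
      intro x hx
      exact hsupp (by simpa using hx)
    have h3 : ∫⁻ x in ball y R, ‖ω' x‖ₑ ≤ ∫⁻ x in ball y R, ‖curl v x‖ₑ := by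
      refine lintegral_mono fun x => ?_
      rw [← ofReal_norm, ← ofReal_norm]
      exact ENNReal.ofReal_le_ofReal (hω'le x)
    have hpq : Real.HolderConjugate 2 2 := ⟨by norm_num, by norm_num, by norm_num⟩
    have h4 := ENNReal.lintegral_mul_le_Lp_mul_Lq (volume.restrict (ball y R)) hpq
      (f := fun _ => (1 : ℝ≥0∞)) (g := fun x => ‖curl v x‖ₑ) aemeasurable_const
      hcurl_cont.enorm.aemeasurable
    have h4' : ∫⁻ x in ball y R, ‖curl v x‖ₑ ≤
        (volume (ball y R)) ^ (1 / 2 : ℝ) * (∫⁻ x in ball y R, ‖curl v x‖ₑ ^ 2) ^ (1 / 2 : ℝ) := by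
      have e1 : ((fun _ => (1 : ℝ≥0∞)) * fun x => ‖curl v x‖ₑ) = fun x => ‖curl v x‖ₑ := by
        funext x; simp
      have e2 : ∫⁻ _ in ball y R, (1 : ℝ≥0∞) ^ (2 : ℝ) = volume (ball y R) := by
        rw [ENNReal.one_rpow, setLIntegral_const, one_mul]
      have e3 : (fun x => ‖curl v x‖ₑ ^ (2 : ℝ)) = fun x => ‖curl v x‖ₑ ^ 2 := by
        funext x; exact ENNReal.rpow_two _
      rw [e1, e2, e3] at h4
      exact h4
    have hvol : volume (ball y R) = ENNReal.ofReal (R ^ 3) * volume (ball (0 : EuclideanSpace ℝ (Fin 3)) 1) := by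
      rw [Measure.addHaar_ball_of_pos _ _ hR, finrank_euclideanSpace, Fintype.card_fin]
    have hvol_top : volume (ball y R) ≠ ⊤ := measure_ball_lt_top.ne
    have hV₁top : volume (ball (0 : EuclideanSpace ℝ (Fin 3)) 1) ≠ ⊤ := measure_ball_lt_top.ne
    -- chain in `ℝ≥0∞`
    have h5 : ∫⁻ x, ‖ω' x‖ₑ ≤
        (volume (ball y R)) ^ (1 / 2 : ℝ) * (ENNReal.ofReal W) ^ (1 / 2 : ℝ) := by
      rw [h2]
      refine (h3.trans h4').trans ?_
      gcongr
    have htop : (volume (ball y R)) ^ (1 / 2 : ℝ) * (ENNReal.ofReal W) ^ (1 / 2 : ℝ) ≠ ⊤ := by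
      refine ENNReal.mul_ne_top ?_ ?_
      · exact ENNReal.rpow_ne_top_of_nonneg (by norm_num) hvol_top
      · exact ENNReal.rpow_ne_top_of_nonneg (by norm_num) ENNReal.ofReal_ne_top
    have h6 := ENNReal.toReal_mono htop h5
    rw [ENNReal.toReal_mul, ← ENNReal.toReal_rpow, ← ENNReal.toReal_rpow, ENNReal.toReal_ofReal hW0, hvol,
      ENNReal.toReal_mul, ENNReal.toReal_ofReal (by positivity)] at h6
    rw [h1, Real.sqrt_eq_rpow, Real.sqrt_eq_rpow, show V₁ * R ^ 3 = R ^ 3 * V₁ by ring]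
    exact h6
  -- (6) assemble
  have hmain : ‖biotSavart ω' y‖ ≤ κ * (ρ * L) + ((4 * Real.pi)⁻¹ * Real.sqrt V₁) * (Real.sqrt (R ^ 3 * W) / ρ ^ 2) := by
    have hρ2 : 0 < ρ ^ 2 := by positivity
    calc ‖biotSavart ω' y‖ ≤ (κ * L) * ρ + (4 * Real.pi)⁻¹ * (ρ ^ 2)⁻¹ * ∫ x, ‖ω' x‖ := by rw [← hIg]; exact hI
      _ ≤ (κ * L) * ρ + (4 * Real.pi)⁻¹ * (ρ ^ 2)⁻¹ * (Real.sqrt (V₁ * R ^ 3) * Real.sqrt W) := by gcongr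
      _ = κ * (ρ * L) + ((4 * Real.pi)⁻¹ * Real.sqrt V₁) * (Real.sqrt (R ^ 3 * W) / ρ ^ 2) := by
          rw [Real.sqrt_mul hV₁0, Real.sqrt_mul (by positivity : (0 : ℝ) ≤ R ^ 3) W]
          field_simp
  have hρL : 0 ≤ ρ * L := by positivity
  have hT : 0 ≤ Real.sqrt (R ^ 3 * W) / ρ ^ 2 := by positivity
  calc ‖biotSavart (cutVorticity v y R) y‖ = ‖biotSavart ω' y‖ := rfl
    _ ≤ κ * (ρ * L) + ((4 * Real.pi)⁻¹ * Real.sqrt V₁) * (Real.sqrt (R ^ 3 * W) / ρ ^ 2) := hmain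
    _ ≤ C * (ρ * L) + C * (Real.sqrt (R ^ 3 * W) / ρ ^ 2) := by gcongr
    _ = C * (ρ * L + Real.sqrt (R ^ 3 * W) / ρ ^ 2) := by ring

/-- H1 (by-name stability of the stub list: now a theorem). -/
theorem stub_helmholtzNearField : HelmholtzNearField := helmholtzNearField_holds

end Summit.NavierStokesRegularity.NavierStokesRegularity.Cruxes.TypeIQuantSubcubicExp.HelmholtzCentre

end
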